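import Summits.AtomisticToContinuum.FouriersLaw.Theses.EmbeddedDrudeMourre
import Summits.AtomisticToContinuum.FouriersLaw.Theorems.EmbeddedDrudeMourreDrudeDissolutionSplit
import Summits.AtomisticToContinuum.FouriersLaw.Theorems.DrudeDissolution.Negative.WindowNotL1
import Summits.AtomisticToContinuum.FouriersLaw.Theorems.DrudeDissolution.Negative.SpectralPairNecessities
import Literature.MathematicalPhysics.KineticTheory.InfiniteChainSuperstableDynamics
import HarnessLib

/-!
# Line `canonical-kinetic-cut` — checked skeleton v1 for the crux `EmbeddedDrudeMourre.DrudeDissolution`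
(stmt-AtomisticToContinuum-12593, the route TARGET / rank-0 auto-crux of `route-AtomisticToContinuum-EmbeddedDrudeMourre`,
sub-problem `AtomisticToContinuum/FouriersLaw`; crux-strategist `planner-cstrat-stmt-AtomisticToContinuum-12593-p1-0`,
WALL-BREAKER pass on the EXHAUSTED chain, 2026-08-17; card `Lines/canonical-kinetic-cut.md`; census `STRATEGY-CENSUS.md` v3;
split package `SPLIT-READY.md` (strategist s2); glue certificate LANDED `Theorems/EmbeddedDrudeMourreDrudeDissolutionSplit.lean` p158912)

Crux (FIXED — the route decl, never restated): for `pinnedChain ω₂ lam β γ` (all four `> 0`) there is `T₀ > 0` such that every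
`T ∈ (0, T₀)` carries a DLR Gibbs state `μ_T`, a `μ_T`-preserving `InfiniteChainDynamics` with absolutely convergent summed
current correlations `C_T`, a finite measure `σ_T` with `C_T(t) = ∫ cos(ωt) dσ_T(ω)` for all `t`, and a window `(−δ, δ)` on
which `σ_T = g dω`, `g` continuous, `≥ 0`, `g 0 > 0`.

## What this line is (one paragraph)

THE DECOMPOSITION CARRIER of stmt-12593 — the image on this crux of the twin's `Cruxes/MourreDissolution/Lines/canonical_kinetic_cut.lean`
(strategist 12594-p1), registered now because the chain is EXHAUSTED: four checked lines are dead (`Sketch` c9/c10, `natural-scale-poisson-sandwich`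
a1/c14, `gram-pencil-harmonic-chaos` c11/c12/c14, `kinetic-polymer-gas-on-the-time-axis` c13/c14 — `Lines/*-dead*.md`), two ideation rounds
produced no surviving idea, and sixteen leads plus three strategist censuses reduced the crux to ONE residue: `t = ∞` control of the CANONICAL
`C_T` (Buttà–Marchioro flow on `bmGood`, the unique shift-invariant DLR state) at fixed small `T`, odd zero-wavenumber current sector. The only
typed cut of that residue into two GENUINE pieces with PROVED glue is the kinetic one, in the crux's own existential currency:
**PKT∃** `stub_bmPostKineticTail` — T-uniform smallness of the far tail `∫_{M T⁻²}^∞ |C_T|` (the wall), and **KL∃** `stub_bmKineticLimit` —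
the wave-kinetic limit on every finite kinetic window `[δT⁻², MT⁻²]` with `∫₀^∞ K > 0` (positivity for free: `FGRGap_proof` +
`kineticConductivityFinite_proof`). The composition `DrudeDissolution_of : PKT∃ → KL∃ → DrudeDissolution` is ONE LINE over the LANDED certificate
`StrategistSplit.drudeDissolution_of_subs` (p158912 = `LineSketch.drudeDissolution_of_bmRigidity_of_bmPostKineticTail_of_bmKineticLimit` p127311 ∘
`LineSketch.stub_bmRigidity` p127446). The two stub statements are VERBATIM (byte-checked, 921 / 965 characters) the children `BmPostKineticTail` /
`BmKineticLimit` of `SPLIT-READY.md` AND of the twin's `SPLIT-PACKAGE.md`, so that (i) a harness-driven final-cycle crux split (D-0027 A7) built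
from THIS skeleton of record yields exactly those two leaves — not the DK-dressed `stub_oneStepContraction`/`stub_oddSectorMarkovGas` of the dead
polymer-gas skeleton that was the skeleton of record until now — and (ii) one split serves both twins (dedupe by signature). Two strategists'
`ledger route edit … --split` were BOUNCED "final-cycle only" (s2 10:47Z, p1 14:25Z): the lead seated here is expected to TAKE THE HARNESS'S
SPLIT OFFER on its final cycle (card §What a lead should do), or any operator / tenure planner may fire `SPLIT-READY.md` verbatim at any time.

## Relation to the dead lines
* Not a Mourre / memory-function / Abel-at-scale / Kotecký–Preiss dress: no conjugate operator, no LAP, no `ZeroWavenumberData` witness, no polymer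
  norm — so none of the four deaths applies at their dying step; the wall (`t = ∞` at fixed `T`) is NOT dodged — nothing can dodge it
  (census §§Transfer–Negation, 22 + 13 + 10 + 11 recorded attempts) — it is ISOLATED into one named stub, PKT∃, about ONE canonical function.
* `Sketch` rev 12 (dead: blocked-on-open) carried the same two stubs behind a third (`stub_bmRigidity`, since LANDED p127446); this skeleton is
  its rigidity-discharged, glue-landed form with an explicit purpose; re-adopting `Sketch` itself is not possible (retired in `lines[]`).

## Disproof / Negative used
`Cruxes/DrudeDissolution/Disproof.lean` (v of 2026-08-16, rc 0; only `drudeDissolution_false_without_temp_pos`; no `-- Targets`, no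
`stub_*_false`): the one `_false_without_` obstruction (`0 < T` is load-bearing) is honoured trivially — both stubs keep `0 < T → T < T₀`.
`Negative/` lemmas imported and checked against: `exists_window_not_integrable` (window ⇏ L¹: PKT∃ is knowingly STRONGER than the crux's
regularity clause — genuineness of the cut, s2 probes CLEAN), `tendsto_cesaro_zero_of_window` / `atom_eq_zero_of_window` (no Drude atom is
NECESSARY — consistent with PKT∃, whose only uniform kill is a T-uniform far-tail mass = a Drude plateau, Disproof "MD probe").
-/

noncomputable section

open MeasureTheory Filter Set Function
open scoped Topology

namespace Summit.AtomisticToContinuum.FouriersLaw.Cruxes.DrudeDissolution.CanonicalKineticCut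

/-! ## §1 Registered stubs (`sorry` only here; every signature self-contained over tree declarations; the two bodies are
VERBATIM the split children `BmPostKineticTail` / `BmKineticLimit` of `SPLIT-READY.md` = twin `SPLIT-PACKAGE.md`) -/

/-- **PKT∃ `stub_bmPostKineticTail` — POST-KINETIC TAIL, EXISTENTIAL BUTTÀ–MARCHIORO FORM (the wall; research-open).**
For every `e > 0` there are `M, T₀ > 0` such that for every `T ∈ (0, T₀)` SOME pair `(μ, D)` — `μ` a DLR state of
`pinnedChain ω₂ lam β γ` at `T` invariant under the unit shift, `D` an infinite-volume dynamics with carrier `bmGood`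
preserving `μ` (canonical by `LineSketch.stub_bmRigidity`, p127446) — has `C_T ∈ L¹(M T⁻², ∞)` with `∫_{M T⁻²}^∞ |C_T| ≤ e`.
Implied by `KineticCorner.PostKineticTail` (stmt-3430; `bmPostKineticTail_of_postKineticTail`, landed). Size: open-problem
(`t = ∞` decorrelation of a deterministic interacting infinite lattice at fixed coupling is proved nowhere; census §Transfer T1–T22).
[AokiLukkarinenSpohn2006; Lukkarinen2016; BonettoLebowitzReyBellet2000 §7; doi:10.1002/cpa.22120 Thm 1.1] -/
theorem stub_bmPostKineticTail :
      ∀ ω₂ lam β γ : ℝ, 0 < ω₂ → 0 < lam → 0 < β → 0 < γ → ∀ e : ℝ, 0 < e →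
      ∃ M T₀ : ℝ, 0 < M ∧
      0 < T₀ ∧
      ∀ T : ℝ, 0 < T → T < T₀ →
        ∃ (μ : MeasureTheory.Measure Literature.MathematicalPhysics.KineticTheory.HeatConduction.ChainConfig) (D : Literature.MathematicalPhysics.KineticTheory.HeatConduction.InfiniteChainDynamics (Literature.MathematicalPhysics.KineticTheory.HeatConduction.pinnedChain ω₂ lam β γ)), (Literature.MathematicalPhysics.KineticTheory.HeatConduction.pinnedChain ω₂ lam β γ).IsChainGibbsMeasure T μ ∧
      MeasureTheory.MeasurePreserving (fun σ : Literature.MathematicalPhysics.KineticTheory.HeatConduction.ChainConfig => fun i : ℤ => σ (i + 1)) μ μ ∧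
      D.carrier = (Literature.MathematicalPhysics.KineticTheory.HeatConduction.pinnedChain ω₂ lam β γ).bmGood ∧
      D.PreservesMeasure μ ∧
      MeasureTheory.IntegrableOn (D.currentCorrelation μ) (Set.Ioi (M / T ^ 2)) ∧
      ∫ t in Set.Ioi (M / T ^ 2), |D.currentCorrelation μ t| ≤ e := by
  sorry

/-- **KL∃ `stub_bmKineticLimit` — WAVE-KINETIC LIMIT ON EVERY KINETIC WINDOW, EXISTENTIAL BUTTÀ–MARCHIORO FORM (XL / research).**
There is `K : ℝ → ℝ`, integrable on `(0, ∞)` with `∫₀^∞ K > 0`, such that for all `0 < δ ≤ M` and `e > 0` there is `T₀ > 0` with, for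
every `T ∈ (0, T₀)`, SOME pair `(μ, D)` as in PKT∃ having `|∫_{δT⁻²}^{MT⁻²} C_T − ∫_δ^M K| ≤ e`. Content: `K(τ) = ⟨v, e^{−τL} v⟩` for
the linearised 2↔2 phonon Boltzmann operator of the PINNED band (ALS06 (3.20)–(3.22), (4.1), (4.11)); positivity `∫K > 0` is already a
THEOREM (`FGRGap_proof` + `kineticConductivityFinite_proof`); open is the window convergence for the thermal lattice with quartic Gibbs data,
for ALL multiples `M`, in `d = 1` (no template: LukkarinenSpohn2011 needs `d ≥ 4` + ℓ₃-dispersivity, failing on 𝕋¹ as `t^{-1/2}`).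
First stubs of ITS chain (card §Stubs): KL1 pair-kernel decay (LANDED as the polymer-gas B-package p150259/p160660/p151030/p150563),
K1 an instance of `HarmonicChaosDecomposition`, KL2 finite-order Duhamel ↦ Boltzmann iterates on finite kinetic windows, KL3 remainder.
Implied by `KineticCorner.KineticLimit` (stmt-3431; `bmKineticLimit_of_kineticLimit`, landed).
[AokiLukkarinenSpohn2006; doi:10.1007/s00222-010-0276-5; DengHani2023; doi:10.1002/cpa.22120; Lukkarinen2016] -/
theorem stub_bmKineticLimit :
      ∀ ω₂ lam β γ : ℝ, 0 < ω₂ → 0 < lam → 0 < β → 0 < γ →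
      ∃ K : ℝ → ℝ, MeasureTheory.IntegrableOn K (Set.Ioi 0) ∧
      0 < ∫ τ in Set.Ioi 0, K τ ∧
      ∀ δ M e : ℝ, 0 < δ → δ ≤ M → 0 < e →
        ∃ T₀ : ℝ, 0 < T₀ ∧
      ∀ T : ℝ, 0 < T → T < T₀ →
        ∃ (μ : MeasureTheory.Measure Literature.MathematicalPhysics.KineticTheory.HeatConduction.ChainConfig) (D : Literature.MathematicalPhysics.KineticTheory.HeatConduction.InfiniteChainDynamics (Literature.MathematicalPhysics.KineticTheory.HeatConduction.pinnedChain ω₂ lam β γ)), (Literature.MathematicalPhysics.KineticTheory.HeatConduction.pinnedChain ω₂ lam β γ).IsChainGibbsMeasure T μ ∧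
      MeasureTheory.MeasurePreserving (fun σ : Literature.MathematicalPhysics.KineticTheory.HeatConduction.ChainConfig => fun i : ℤ => σ (i + 1)) μ μ ∧
      D.carrier = (Literature.MathematicalPhysics.KineticTheory.HeatConduction.pinnedChain ω₂ lam β γ).bmGood ∧
      D.PreservesMeasure μ ∧
      |(∫ t in (δ / T ^ 2)..(M / T ^ 2), D.currentCorrelation μ t) - ∫ τ in δ..M, K τ| ≤ e := by
  sorry

/-! ## §2 The composition (sorry-free; concludes the crux BY NAME) -/

/-- **`DrudeDissolution ⇐ PKT∃ ∧ KL∃`** — one line over the LANDED split certificate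
`StrategistSplit.drudeDissolution_of_subs` (p158912; = p127311 ∘ p127446). [folklore] -/
theorem DrudeDissolution_of :
    (∀ ω₂ lam β γ : ℝ, 0 < ω₂ → 0 < lam → 0 < β → 0 < γ → ∀ e : ℝ, 0 < e →
      ∃ M T₀ : ℝ, 0 < M ∧
      0 < T₀ ∧
      ∀ T : ℝ, 0 < T → T < T₀ →
        ∃ (μ : MeasureTheory.Measure Literature.MathematicalPhysics.KineticTheory.HeatConduction.ChainConfig) (D : Literature.MathematicalPhysics.KineticTheory.HeatConduction.InfiniteChainDynamics (Literature.MathematicalPhysics.KineticTheory.HeatConduction.pinnedChain ω₂ lam β γ)), (Literature.MathematicalPhysics.KineticTheory.HeatConduction.pinnedChain ω₂ lam β γ).IsChainGibbsMeasure T μ ∧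
      MeasureTheory.MeasurePreserving (fun σ : Literature.MathematicalPhysics.KineticTheory.HeatConduction.ChainConfig => fun i : ℤ => σ (i + 1)) μ μ ∧
      D.carrier = (Literature.MathematicalPhysics.KineticTheory.HeatConduction.pinnedChain ω₂ lam β γ).bmGood ∧
      D.PreservesMeasure μ ∧
      MeasureTheory.IntegrableOn (D.currentCorrelation μ) (Set.Ioi (M / T ^ 2)) ∧
      ∫ t in Set.Ioi (M / T ^ 2), |D.currentCorrelation μ t| ≤ e) →
    (∀ ω₂ lam β γ : ℝ, 0 < ω₂ → 0 < lam → 0 < β → 0 < γ →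
      ∃ K : ℝ → ℝ, MeasureTheory.IntegrableOn K (Set.Ioi 0) ∧
      0 < ∫ τ in Set.Ioi 0, K τ ∧
      ∀ δ M e : ℝ, 0 < δ → δ ≤ M → 0 < e →
        ∃ T₀ : ℝ, 0 < T₀ ∧
      ∀ T : ℝ, 0 < T → T < T₀ →
        ∃ (μ : MeasureTheory.Measure Literature.MathematicalPhysics.KineticTheory.HeatConduction.ChainConfig) (D : Literature.MathematicalPhysics.KineticTheory.HeatConduction.InfiniteChainDynamics (Literature.MathematicalPhysics.KineticTheory.HeatConduction.pinnedChain ω₂ lam β γ)), (Literature.MathematicalPhysics.KineticTheory.HeatConduction.pinnedChain ω₂ lam β γ).IsChainGibbsMeasure T μ ∧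
      MeasureTheory.MeasurePreserving (fun σ : Literature.MathematicalPhysics.KineticTheory.HeatConduction.ChainConfig => fun i : ℤ => σ (i + 1)) μ μ ∧
      D.carrier = (Literature.MathematicalPhysics.KineticTheory.HeatConduction.pinnedChain ω₂ lam β γ).bmGood ∧
      D.PreservesMeasure μ ∧
      |(∫ t in (δ / T ^ 2)..(M / T ^ 2), D.currentCorrelation μ t) - ∫ τ in δ..M, K τ| ≤ e) →
    Summit.AtomisticToContinuum.FouriersLaw.Theses.EmbeddedDrudeMourre.DrudeDissolution :=
  fun h₁ h₂ =>
    Summit.AtomisticToContinuum.FouriersLaw.Theorems.DrudeDissolution.StrategistSplit.drudeDissolution_of_subs h₁ h₂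

/-- The same composition with the registered stubs plugged in (documents that the two `sorry`s are the ONLY gap). [folklore] -/
theorem drudeDissolution_of_stubs :
    Summit.AtomisticToContinuum.FouriersLaw.Theses.EmbeddedDrudeMourre.DrudeDissolution :=
  DrudeDissolution_of stub_bmPostKineticTail stub_bmKineticLimit

/-- The twin crux follows from the same two stubs (landed weakening inside `StrategistSplit.mourreDissolution_of_subs`). [folklore] -/
theorem mourreDissolution_of_stubs :
    Summit.AtomisticToContinuum.FouriersLaw.Theses.EmbeddedDrudeMourre.MourreDissolution :=
  Summit.AtomisticToContinuum.FouriersLaw.Theorems.DrudeDissolution.StrategistSplit.mourreDissolution_of_subs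
    stub_bmPostKineticTail stub_bmKineticLimit

/-! ## §3 Genuineness checks against the landed `Negative/` lemmas (documentation by elaboration: the names resolve and have the
expected shape; the cheap implication probes were run by s2, `#h21_crux_probe` CLEAN ×2, and are not repeated here) -/

example := @Summit.AtomisticToContinuum.FouriersLaw.Theorems.DrudeDissolution.Negative.exists_window_not_integrable
example := @Summit.AtomisticToContinuum.FouriersLaw.Theorems.DrudeDissolution.Negative.tendsto_cesaro_zero_of_window
example := @Summit.AtomisticToContinuum.FouriersLaw.Theorems.DrudeDissolution.Negative.atom_eq_zero_of_window

end Summit.AtomisticToContinuum.FouriersLaw.Cruxes.DrudeDissolution.CanonicalKineticCut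

end
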